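import Literature.NumberTheory.EllipticCurves.IwasawaAlgebraGenericLayerTwistFiniteProofs
import Literature.NumberTheory.EllipticCurves.IwasawaDualLayerCoinvariantsProofs
import HarnessLib

/-!
# Layer-`n` twisted coinvariants through Pontryagin-dual data over `Λ = ℤ_p⟦T⟧`: the element
# `θ_{n,u} = (u·(1 + T))^{p^n} − 1` versus the twisted coboundary `ψ_{n,u} = (u·φ)^{p^n} − 1`, and
# GENERIC twists at every layer (PROOFS)

Proofs file (theorems only: no `def`, no named fact, no instance, no notation). Sequel of
`IwasawaTwistedCoinvariantsProofs` (the case `n = 0`: `θ_u = u·(1+T) − 1` ↔ `ψ_u = u·φ − 1`) and of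
`IwasawaAlgebraGenericLayerTwistFiniteProofs` (the `Λ`-algebra: `X[θ_{n,u}]`, `X/θ_{n,u}X` finite for all but
finitely many `u`). Source: R. Greenberg, *Iwasawa theory for elliptic curves*, LNM 1716 (1999), proof of
Lemma 4.6 (p. 108: "for all but finitely many values of `s`, `S_{A_s}(F_∞)^{Γ_n}` will be finite for all
`n ≥ 0`") and of Props. 4.14 / 4.15 (pp. 123–125), and Greenberg–Vatsal, Invent. Math. 142 (2000), proof of
Prop. (2.1), requirements (i)/(ii) («`(S_A(ℚ_∞) ⊗ κ^t)^{Γ_n}` is finite for all `n ≥ 0`»): the twisted action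
of `γ` on a discrete `Γ`-module is `u·conj_γ` (`u = κ(γ)^s`), so the subgroup `Γ_n = Γ^{p^n}` acts through
`(u·conj_γ)^{p^n}`; on the compact side (`γ ↦ 1 + T`) this is the element
`θ_{n,u} = (C(u)·(X + 1))^{p^n} − 1` of `Λ`. Everything is stated in the SHAPE of the tree's Pontryagin-dual
data `(S, φ; X, toDual : X → Hom(S, A))` with the two axioms `T ↦ φ − 1`, `C c ↦ (c mod p^k)`
(`WeierstrassCurve.SelmerDualData`, `GreenbergVatsal2000.NonPrimitiveDualData`):

* `toDual_C_mul_X_add_one_pow_smul` — `toDual ((C u·(X+1))^m • x) s = toDual x ((u·φ)^m s)`;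
  **`toDual_layerTheta_smul`** — `toDual (θ_{n,u} • x) s = toDual x ((u·φ)^{p^n} s − s)`;
* `torsionBy_layerTheta_eq_bot_of_forall_exists` (`ψ_{n,u}(S) = S ⟹ X[θ_{n,u}] = 0`, `toDual` injective),
  `forall_exists_of_torsionBy_layerTheta_eq_bot` (`X[θ_{n,u}] = 0 ⟹ ψ_{n,u}(S) = S`, `toDual` ONTO
  `Hom(S, ℚ/ℤ)`: `ℚ/ℤ` is an injective cogenerator, Mathlib `CharacterModule`);
* `forall_finite_eq_bot_of_forall_exists_layer`: `ψ_{n,u}(S) = S` for ONE `u ≡ 1 (mod p)` and one `n` ⟹ `X`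
  has no nonzero finite `Λ`-submodule (Nakayama, `θ_{n,u} ∈ 𝔪_Λ`);
* **`finite_setOf_not_forall_exists_layer`** — `X` finitely generated WITHOUT nonzero finite
  `Λ`-submodules and `toDual` onto `Hom(S, ℚ/ℤ)` ⟹ for every `n`, `ψ_{n,u}(S) = S` for all but finitely many
  `u ≡ 1 (mod p)` (the layer-`n` twin of `IwasawaDual.finite_setOf_not_forall_exists`);
* §2, in the tree's `IwasawaDual.IsDualPair p (φ − 1) toDual` currency (`WeierstrassCurve.SelmerDualData.isDualPair`):
  `IsDualPair.finite_quotient_layerTheta_iff` — **`X/θ_{n,u}X` finite ⟺ the twisted `Γ_n`-invariants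
  `{s | (u·φ)^{p^n} s = s}` finite** (the tree's layer duality `IsDualPair.finite_quotient_iff_of_smul` of
  `IwasawaDualLayerCoinvariantsProofs`, which treats the untwisted `ω_n = (1+T)^{pⁿ} − 1`);
  **`IsDualPair.finite_setOf_not_finite_twistedLayerInvariants`** — `X` finitely generated TORSION ⟹ for every
  `n` the twisted `Γ_n`-invariants are finite for all but finitely many `u ≡ 1 (mod p)` = Greenberg–Vatsal's
  requirement (i) «`(S_A(ℚ_∞) ⊗ κ^t)^{Γ_n}` finite» / Greenberg p. 108, in discrete form;
  `IsDualPair.finite_setOf_not_forall_exists_layer`.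

Use: cell `bsd-2adic`, seat `t42` (GEN 31): the layered form of Greenberg–Vatsal Prop. (2.1) at `p = 2`
(surjectivity onto the local factors, argued along the layers `ℚ_n` of the cyclotomic tower) needs the
generic behaviour of the twisted `Γ_n`-(co)invariants. Nothing about Selmer groups or Galois cohomology is
asserted here; BSD is not advanced by this file.

References: [GreenbergLNM1716] §4 p. 104 ("an easy exercise"), pp. 107–108, p. 115 (`θ_s`), p. 117,
pp. 123–125; [GreenbergVatsal2000] §2 (proof of Prop. 2.1); [Washington1997] §13.2 (Nakayama over `Λ`).
-/

set_option autoImplicit false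

noncomputable section

open scoped Classical

universe u

namespace Literature.NumberTheory.EllipticCurves.IwasawaDual

/-! ## §1 `θ_{n,u}` acts through `toDual` as the layer-`n` twisted coboundary `(u·φ)^{p^n} − 1` -/

section Dual

variable {p : ℕ} [hp : Fact p.Prime] {S : Type*} [AddCommGroup S] {A : Type*} [AddCommGroup A] (φ : AddMonoid.End S)
  {X : Type*} [AddCommGroup X] [Module (IwasawaAlgebra p) X] (d : X →+ (S →+ A))

/-- The twisted operator `s ↦ u·φ s` is additive, and so are its iterates. [folklore] -/
private theorem iterate_twist_add (u : ℤ) (m : ℕ) (a b : S) :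
    (fun t ↦ u • φ t)^[m] (a + b) = (fun t ↦ u • φ t)^[m] a + (fun t ↦ u • φ t)^[m] b := by
  induction m generalizing a b with
  | zero => rfl
  | succ m ih =>
    rw [Function.iterate_succ_apply, Function.iterate_succ_apply, Function.iterate_succ_apply,
      ← ih, map_add, smul_add]

/-- **`(C u·(X + 1))^m` acts through `toDual` as `(u·φ)^m`**: for dual data `(X, d)` of `(S, φ)` (axioms
`T ↦ φ − 1` and `C c ↦ (c mod p^k)` on `p^k`-torsion elements) and an integer `u`,
`d(((C u·(X+1))^m) • x) s = d x ((u·φ)^m s)`. [cite: GreenbergLNM1716, §4 pp. 107, 115] -/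
theorem toDual_C_mul_X_add_one_pow_smul (htor : ∀ s : S, ∃ k : ℕ, p ^ k • s = 0)
    (hT : ∀ (x : X) (s : S), d ((PowerSeries.X : IwasawaAlgebra p) • x) s = d x (φ s) - d x s)
    (hC : ∀ (c : ℤ_[p]) (x : X) (s : S) (k : ℕ), (p ^ k) • s = 0 →
      d (PowerSeries.C c • x) s = (PadicInt.toZModPow k c).val • d x s)
    (u : ℤ) (m : ℕ) (x : X) (s : S) :
    d (((PowerSeries.C (u : ℤ_[p]) * (PowerSeries.X + 1)) ^ m : IwasawaAlgebra p) • x) s =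
      d x ((fun t ↦ u • φ t)^[m] s) := by
  have hone : ∀ (y : X) (t : S), d ((PowerSeries.C (u : ℤ_[p]) * (PowerSeries.X + 1) : IwasawaAlgebra p) • y) t =
      d y (u • φ t) := by
    intro y t
    have h := toDual_theta_smul φ d htor hT hC u y t
    rw [sub_smul, one_smul, map_sub, AddMonoidHom.sub_apply, sub_eq_iff_eq_add] at h
    rw [h, map_sub, sub_add_cancel]
  induction m generalizing s with
  | zero => rw [pow_zero, one_smul, Function.iterate_zero, id]
  | succ m ih =>
    rw [pow_succ', mul_smul, hone, ih, Function.iterate_succ_apply]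

/-- **`θ_{n,u}` acts through `toDual` as `ψ_{n,u} = (u·φ)^{p^n} − 1`**:
`d(θ_{n,u} • x) s = d x ((u·φ)^{p^n} s − s)` — the layer-`n` twisted coboundary (the twisted action of the
generator `γ^{p^n}` of `Γ_n` minus the identity). [cite: GreenbergLNM1716, §4 pp. 107–108, 115]
[cite: GreenbergVatsal2000, §2 (proof of Prop. 2.1)] -/
theorem toDual_layerTheta_smul (htor : ∀ s : S, ∃ k : ℕ, p ^ k • s = 0)
    (hT : ∀ (x : X) (s : S), d ((PowerSeries.X : IwasawaAlgebra p) • x) s = d x (φ s) - d x s)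
    (hC : ∀ (c : ℤ_[p]) (x : X) (s : S) (k : ℕ), (p ^ k) • s = 0 →
      d (PowerSeries.C c • x) s = (PadicInt.toZModPow k c).val • d x s)
    (u : ℤ) (n : ℕ) (x : X) (s : S) :
    d (((PowerSeries.C (u : ℤ_[p]) * (PowerSeries.X + 1)) ^ p ^ n - 1 : IwasawaAlgebra p) • x) s =
      d x ((fun t ↦ u • φ t)^[p ^ n] s - s) := by
  rw [sub_smul, one_smul, map_sub, AddMonoidHom.sub_apply,
    toDual_C_mul_X_add_one_pow_smul φ d htor hT hC, map_sub]

/-- **`ψ_{n,u}(S) = S` ⟹ `X[θ_{n,u}] = 0`** (`d` injective): a `θ_{n,u}`-torsion `x` gives a character `d x`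
vanishing on `ψ_{n,u}(S) = S`. Dual form of «the twisted `Γ_n`-coinvariants vanish».
[cite: GreenbergLNM1716, §4 p. 124] -/
theorem torsionBy_layerTheta_eq_bot_of_forall_exists (htor : ∀ s : S, ∃ k : ℕ, p ^ k • s = 0)
    (hT : ∀ (x : X) (s : S), d ((PowerSeries.X : IwasawaAlgebra p) • x) s = d x (φ s) - d x s)
    (hC : ∀ (c : ℤ_[p]) (x : X) (s : S) (k : ℕ), (p ^ k) • s = 0 →
      d (PowerSeries.C c • x) s = (PadicInt.toZModPow k c).val • d x s)
    (hinj : Function.Injective d) (u : ℤ) (n : ℕ)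
    (hsurj : ∀ s : S, ∃ s' : S, (fun t ↦ u • φ t)^[p ^ n] s' - s' = s) :
    Submodule.torsionBy (IwasawaAlgebra p) X
        (((PowerSeries.C (u : ℤ_[p]) * (PowerSeries.X + 1)) ^ p ^ n - 1 : IwasawaAlgebra p)) = ⊥ := by
  rw [eq_bot_iff]
  intro x hx
  rw [Submodule.mem_torsionBy_iff] at hx
  rw [Submodule.mem_bot]
  apply hinj
  rw [map_zero]
  ext s
  obtain ⟨s', rfl⟩ := hsurj s
  rw [← toDual_layerTheta_smul φ d htor hT hC u n x s', hx, map_zero, AddMonoidHom.zero_apply,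
    AddMonoidHom.zero_apply]

end Dual

section DualCircle

variable {p : ℕ} [hp : Fact p.Prime] {S : Type*} [AddCommGroup S] (φ : AddMonoid.End S)
  {X : Type u} [AddCommGroup X] [Module (IwasawaAlgebra p) X] (d : X →+ (S →+ AddCircle (1 : ℚ)))

/-- **`X[θ_{n,u}] = 0` ⟹ `ψ_{n,u}(S) = S`** when `d` maps ONTO the character group `Hom(S, ℚ/ℤ)`: a
non-zero character of `S/ψ_{n,u}(S)` would be a non-zero `θ_{n,u}`-torsion element.
[cite: GreenbergLNM1716, §4 p. 104 ("an easy exercise")] -/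
theorem forall_exists_of_torsionBy_layerTheta_eq_bot (htor : ∀ s : S, ∃ k : ℕ, p ^ k • s = 0)
    (hT : ∀ (x : X) (s : S), d ((PowerSeries.X : IwasawaAlgebra p) • x) s = d x (φ s) - d x s)
    (hC : ∀ (c : ℤ_[p]) (x : X) (s : S) (k : ℕ), (p ^ k) • s = 0 →
      d (PowerSeries.C c • x) s = (PadicInt.toZModPow k c).val • d x s)
    (hbij : Function.Bijective d) (u : ℤ) (n : ℕ)
    (hθ : Submodule.torsionBy (IwasawaAlgebra p) X
        (((PowerSeries.C (u : ℤ_[p]) * (PowerSeries.X + 1)) ^ p ^ n - 1 : IwasawaAlgebra p)) = ⊥) :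
    ∀ s : S, ∃ s' : S, (fun t ↦ u • φ t)^[p ^ n] s' - s' = s := by
  let ψ : S →+ S := AddMonoidHom.mk' (fun s ↦ (fun t ↦ u • φ t)^[p ^ n] s - s) fun a b ↦ by
    rw [iterate_twist_add]; abel
  by_contra hns
  simp only [not_forall, not_exists] at hns
  obtain ⟨s, hs⟩ := hns
  have hsr : s ∉ ψ.range := by
    rintro ⟨s', hs'⟩
    exact hs s' hs'
  have hne : (QuotientAddGroup.mk' ψ.range s) ≠ 0 := by
    rwa [Ne, QuotientAddGroup.mk'_apply, QuotientAddGroup.eq_zero_iff]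
  obtain ⟨χQ, hχQ⟩ := CharacterModule.exists_character_apply_ne_zero_of_ne_zero hne
  let χ : S →+ AddCircle (1 : ℚ) := (χQ : _ →+ AddCircle (1 : ℚ)).comp (QuotientAddGroup.mk' ψ.range)
  obtain ⟨x, hx⟩ := hbij.2 χ
  have hχψ : ∀ t : S, χ ((fun t ↦ u • φ t)^[p ^ n] t - t) = 0 := fun t ↦ by
    show χQ (QuotientAddGroup.mk' ψ.range (ψ t)) = 0
    rw [QuotientAddGroup.mk'_apply,
      (QuotientAddGroup.eq_zero_iff _).mpr (AddMonoidHom.mem_range.mpr ⟨t, rfl⟩), map_zero]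
  have hθx : (((PowerSeries.C (u : ℤ_[p]) * (PowerSeries.X + 1)) ^ p ^ n - 1 : IwasawaAlgebra p)) • x = 0 := by
    apply hbij.1
    rw [map_zero]
    ext t
    rw [toDual_layerTheta_smul φ d htor hT hC u n x t, hx, hχψ, AddMonoidHom.zero_apply]
  have hx0 : x = 0 := by
    have hmem : x ∈ Submodule.torsionBy (IwasawaAlgebra p) X
        (((PowerSeries.C (u : ℤ_[p]) * (PowerSeries.X + 1)) ^ p ^ n - 1 : IwasawaAlgebra p)) :=
      (Submodule.mem_torsionBy_iff _ _).mpr hθx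
    rwa [hθ, Submodule.mem_bot] at hmem
  apply hχQ
  show χ s = 0
  rw [← hx, hx0, map_zero, AddMonoidHom.zero_apply]

/-- **Twisted descent at layer `n`, the `Λ`-conclusion**: if for ONE integer `u ≡ 1 (mod p)` and one `n` the
layer-`n` twisted coboundary `ψ_{n,u} = (u·φ)^{p^n} − 1` maps `S` onto `S`, then `X` (`d` injective) has no
non-zero finite `Λ`-submodule (Nakayama: `θ_{n,u} ∈ 𝔪_Λ` has a kernel on every non-zero finite submodule).
[cite: GreenbergLNM1716, §4 p. 124] [cite: Washington1997, §13.2] -/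
theorem forall_finite_eq_bot_of_forall_exists_layer (htor : ∀ s : S, ∃ k : ℕ, p ^ k • s = 0)
    (hT : ∀ (x : X) (s : S), d ((PowerSeries.X : IwasawaAlgebra p) • x) s = d x (φ s) - d x s)
    (hC : ∀ (c : ℤ_[p]) (x : X) (s : S) (k : ℕ), (p ^ k) • s = 0 →
      d (PowerSeries.C c • x) s = (PadicInt.toZModPow k c).val • d x s)
    (hinj : Function.Injective d) {u : ℤ} (hu : (p : ℤ) ∣ u - 1) (n : ℕ)
    (hsurj : ∀ s : S, ∃ s' : S, (fun t ↦ u • φ t)^[p ^ n] s' - s' = s) :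
    ∀ N : Submodule (IwasawaAlgebra p) X, Finite N → N = ⊥ :=
  IwasawaAlgebra.forall_finite_eq_bot_of_torsionBy_eq_bot p (IwasawaAlgebra.layerTheta_mem_maximalIdeal p hu n)
    (torsionBy_layerTheta_eq_bot_of_forall_exists φ d htor hT hC hinj u n hsurj)

/-- **Generic vanishing of the layer-`n` twisted coinvariants.** If the dual datum `(X, d)` of `(S, φ)`
(`d` onto `Hom(S, ℚ/ℤ)`) is finitely generated over `Λ` without non-zero finite `Λ`-submodule, then for every
`n` the twisted coboundary `ψ_{n,u} = (u·φ)^{p^n} − 1` maps `S` onto `S` for all but finitely many integers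
`u ≡ 1 (mod p)` («`(S ⊗ κ^s)_{Γ_n} = 0` for all but finitely many `s`»).
[cite: GreenbergLNM1716, §4 pp. 117, 124] [cite: GreenbergVatsal2000, §2 (proof of Prop. 2.1)] -/
theorem finite_setOf_not_forall_exists_layer [Module.Finite (IwasawaAlgebra p) X]
    (htor : ∀ s : S, ∃ k : ℕ, p ^ k • s = 0)
    (hT : ∀ (x : X) (s : S), d ((PowerSeries.X : IwasawaAlgebra p) • x) s = d x (φ s) - d x s)
    (hC : ∀ (c : ℤ_[p]) (x : X) (s : S) (k : ℕ), (p ^ k) • s = 0 →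
      d (PowerSeries.C c • x) s = (PadicInt.toZModPow k c).val • d x s)
    (hbij : Function.Bijective d) (h : ∀ N : Submodule (IwasawaAlgebra p) X, Finite N → N = ⊥) (n : ℕ) :
    {u : ℤ | (p : ℤ) ∣ u - 1 ∧ ¬ ∀ s : S, ∃ s' : S, (fun t ↦ u • φ t)^[p ^ n] s' - s' = s}.Finite := by
  refine (IwasawaAlgebra.finite_setOf_torsionBy_layerTheta_ne_bot p (M := X) h n).subset ?_
  rintro u ⟨hu, hnot⟩
  refine ⟨hu, fun hbot => hnot ?_⟩
  exact forall_exists_of_torsionBy_layerTheta_eq_bot φ d htor hT hC hbij u n hbot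

end DualCircle

/-! ## §2 In the `IsDualPair` currency: the twisted `Γ_n`-invariants `{s | (u·φ)^{p^n} s = s}` are finite
for all but finitely many `u` (Greenberg–Vatsal's requirement (i) / Greenberg p. 108), and dual to `X/θ_{n,u}X` -/

section DualPair

variable {p : ℕ} [hp : Fact p.Prime] {S : Type*} [AddCommGroup S] {φ : AddMonoid.End S}
  {X : Type u} [AddCommGroup X] [Module (IwasawaAlgebra p) X] {toDual : X →+ (S →+ AddCircle (1 : ℚ))}

/-- For a dual pair `(X, toDual)` of `(S, φ − 1)` (`WeierstrassCurve.SelmerDualData.isDualPair`: `φ = conj_γ`):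
`toDual (θ_{n,u} • x) s = toDual x ((u·φ)^{p^n} s − s)`. [cite: GreenbergLNM1716, §4 pp. 107–108, 115] -/
theorem IsDualPair.toDual_layerTheta_smul (h : IsDualPair p (φ - 1) toDual) (u : ℤ) (n : ℕ) (x : X) (s : S) :
    toDual (((PowerSeries.C (u : ℤ_[p]) * (PowerSeries.X + 1)) ^ p ^ n - 1 : IwasawaAlgebra p) • x) s =
      toDual x ((fun t ↦ u • φ t)^[p ^ n] s - s) :=
  IwasawaDual.toDual_layerTheta_smul φ toDual h.locNil.torsion
    (fun x s ↦ by rw [h.T_smul, End_sub_apply, AddMonoid.End.one_apply, map_sub]) h.C_smul u n x s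

/-- **Pontryagin duality at the twisted layer**: for a dual pair, `X/θ_{n,u}X` is finite iff the twisted
`Γ_n`-invariants `{s | (u·φ)^{p^n} s = s}` are finite (`IsDualPair.finite_quotient_iff_of_smul` applied to
`θ_{n,u} ↔ (u·φ)^{p^n} − 1`). [cite: GreenbergLNM1716, §1 p. 60, §4 p. 108] -/
theorem IsDualPair.finite_quotient_layerTheta_iff (h : IsDualPair p (φ - 1) toDual) (u : ℤ) (n : ℕ) :
    Finite (X ⧸ (Ideal.span {(((PowerSeries.C (u : ℤ_[p]) * (PowerSeries.X + 1)) ^ p ^ n - 1 :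
        IwasawaAlgebra p))} • (⊤ : Submodule (IwasawaAlgebra p) X))) ↔
      {s : S | (fun t ↦ u • φ t)^[p ^ n] s = s}.Finite := by
  -- the layer-`n` twisted coboundary as an additive endomorphism
  let g : AddMonoid.End S := AddMonoidHom.mk' (fun s ↦ (fun t ↦ u • φ t)^[p ^ n] s - s) fun a b ↦ by
    rw [iterate_twist_add]; abel
  have hg : ∀ (x : X) (s : S), toDual ((((PowerSeries.C (u : ℤ_[p]) * (PowerSeries.X + 1)) ^ p ^ n - 1 :
      IwasawaAlgebra p)) • x) s = toDual x (g s) := fun x s ↦ h.toDual_layerTheta_smul u n x s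
  have hset : {s : S | (fun t ↦ u • φ t)^[p ^ n] s = s} = (endInvariants g : Set S) := by
    ext s
    rw [Set.mem_setOf_eq, SetLike.mem_coe, AddMonoidHom.mem_ker, AddMonoidHom.coe_coe]
    show _ ↔ (fun t ↦ u • φ t)^[p ^ n] s - s = 0
    rw [sub_eq_zero]
  rw [h.finite_quotient_iff_of_smul hg, hset]
  exact ⟨fun hf ↦ @Set.toFinite S _ hf, fun hs ↦ hs.to_subtype⟩

/-- **Greenberg–Vatsal's requirement (i) at every layer** («`(S_A(ℚ_∞) ⊗ κ^t)^{Γ_n}` is finite … for all but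
finitely many values of `t`», GV p. 18; Greenberg p. 108: «for all but finitely many values of `s`,
`S_{A_s}(F_∞)^{Γ_n}` will be finite»): if the dual pair has `X` finitely generated and TORSION over `Λ`, then
for every `n` the twisted `Γ_n`-invariants `{s ∈ S | (u·φ)^{p^n} s = s}` are finite for all but finitely many
integers `u ≡ 1 (mod p)`. [cite: GreenbergVatsal2000, §2 (proof of Prop. 2.1)] [cite: GreenbergLNM1716, §4 p. 108] -/
theorem IsDualPair.finite_setOf_not_finite_twistedLayerInvariants (h : IsDualPair p (φ - 1) toDual)
    [Module.Finite (IwasawaAlgebra p) X] (hX : Module.IsTorsion (IwasawaAlgebra p) X) (n : ℕ) :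
    {u : ℤ | (p : ℤ) ∣ u - 1 ∧ ¬ {s : S | (fun t ↦ u • φ t)^[p ^ n] s = s}.Finite}.Finite := by
  refine (IwasawaAlgebra.finite_setOf_not_finite_quotient_layerTheta p hX n).subset ?_
  rintro u ⟨hu, hnot⟩
  exact ⟨hu, fun hfin ↦ hnot ((h.finite_quotient_layerTheta_iff u n).mp hfin)⟩

/-- **Generic vanishing of the twisted `Γ_n`-coinvariants, dual-pair form**: if `X` is finitely generated
without non-zero finite `Λ`-submodule, then for every `n` and all but finitely many `u ≡ 1 (mod p)` the twisted
coboundary `(u·φ)^{p^n} − 1` maps `S` onto `S`. [cite: GreenbergLNM1716, §4 p. 124] -/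
theorem IsDualPair.finite_setOf_not_forall_exists_layer (h : IsDualPair p (φ - 1) toDual)
    [Module.Finite (IwasawaAlgebra p) X] (hN : ∀ N : Submodule (IwasawaAlgebra p) X, Finite N → N = ⊥) (n : ℕ) :
    {u : ℤ | (p : ℤ) ∣ u - 1 ∧ ¬ ∀ s : S, ∃ s' : S, (fun t ↦ u • φ t)^[p ^ n] s' - s' = s}.Finite :=
  IwasawaDual.finite_setOf_not_forall_exists_layer φ toDual h.locNil.torsion
    (fun x s ↦ by rw [h.T_smul, End_sub_apply, AddMonoid.End.one_apply, map_sub]) h.C_smul h.bijective hN n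

end DualPair

end Literature.NumberTheory.EllipticCurves.IwasawaDual

end
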